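import Summits.QuantumFields.YangMills.Theorems.ForcedResponseSkewnessRunningCouplingCeilingLogCeilingOfFemtoToolkit
import Summits.QuantumFields.YangMills.Theorems.ForcedResponseSkewnessRunningCouplingCeilingScaleFreeOfMomentBounds
import HarnessLib

/-!
# Route `ForcedResponseSkewness`, crux `RunningCouplingCeiling` (stmt-QuantumFields-24275), line «pointwise-log-ceiling-r»:
# BOTH registered stubs from FEMTO-cube statements (body forms; route-independent)

Helper file (`--supports stmt-QuantumFields-24275`) of the width prover `ym-line-frs-p3` (g5).  The registered skeleton
`Cruxes/RunningCouplingCeiling/Lines/pointwise_log_ceiling_r.lean` (lead `ym-line-frs-p1`) closes the crux modulo two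
torus-level kernel statements along a pinned unit map: `stub_scaleFreeLocal : ScaleFreeLocalPinnedSigR` (`d⁸|torusCov| ≤ C₁(ℓ)`
at physical separation `≤ ℓ`) and `stub_logCeiling : LogCeilingSigR` (`d⁸|torusCov| ≤ C₀/log²(1/(a(β)d))` below half the unit).
Exactly as the lead's line «femto-collar» does for the deciding crux (`ContactKernelSigR ⇐ FBL ∧ NearCovLaw`), this file
expresses both through FEMTO-CUBE statements with frozen exteriors — the currency of the record's femto package
(`DlrCollarTransfer.FBL`, `FC2`) — for a fixed `(G, r, a)`:

* §1 `localScaleFree_of_fbl` — `FBL G r a →` the local scale-free bound (body of `ScaleFreeLocal[Pinned]SigR`):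
  `DlrCollarTransfer.stub_collar` (`FBL → MomentBounds`) ∘ `localScaleFree_of_momentBounds` (p593932).
* §2 `logCeiling_of_femto` — scale-free bound at range `1/2` ∧ `FBL G r a` ∧ FEMTO LOG TWO-POINT LAW `→` the body of
  `LogCeilingSigR`.  The femto log two-point law (an explicit hypothesis — not a registered stub, not a literature fact) is the
  UPPER clause of the record's `FC2` with the asymptotic-freedom shape `Γ(s) = 1/log²(1/s)` and one scale-indexed collar
  `K(s)·‖y−x‖ ≤ depth` (`K ≥ 1`, `s·K(s) → 0`): on every femto cube, for ALL exteriors `η`,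
  `‖y−x‖⁸ |kerCov_η(dens x, dens y)| ≤ C₂ / log²(1/(‖y−x‖·a(β)))`.  Mechanism: put the pair in ONE cube of physical size `≈ ℓ/4`
  around `x`; the femto law bounds the conditional covariance, `FBL` bounds the covariance of the conditional means by
  `4(C₁/D⁴)²` with `d/D ≤ 16s/(3ℓ)`, and `s⁸ log²(1/s) ≤ 1`; the range `[ℓ*, 1/2]` is covered by the scale-free bound.
The Sig-level / by-name compositions are in `…RunningCouplingCeilingOfFemto.lean`.

Physics remark (why the femto law is the right debt): an exterior forces a classical flux background `B(D) ≍ D⁻²` at depth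
`D`, which contaminates `d⁸·Cov(dens x, dens y)` by `≍ ḡ²(s)(d/D)⁴`; the log² ceiling therefore needs `K(s) ≳ ḡ(s)^{-1/2}
≍ log^{1/4}(1/s)`, compatible with `s·K(s) → 0` — the same collar device as the record's `FC2`.  In the free (abelian,
non-running) curvature model the log clause FAILS (`…RunningCouplingCeilingGaussModel.gaussModel_not_logDecay`, p597038).

No summit is proved by any of this: the line is a CONDITIONAL rung line (leaf R2a `BalabanLadder.NT`, residual
`FloorWithScalingLimits` 24873); `stub_logCeiling` is only REDUCED to a femto statement; the Yang–Mills mass gap is NOT proved.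
Refs: Georgii, Gibbs Measures (2011) Thm. 4.17 (DLR consistency); Bałaban, CMP 122 (1989) (running coupling, effective
actions); Magnen–Rivasseau–Sénéor, CMP 155 (1993).
-/

set_option autoImplicit false

noncomputable section

namespace Summit.QuantumFields.YangMills.Cruxes.RunningCouplingCeiling.Pointwise

open scoped SchwartzMap
open MeasureTheory Filter Topology
open Literature.MathematicalPhysics.QuantumFieldTheory Literature.MathematicalPhysics.QuantumLattice
open Literature.Probability.LatticeModels
open Summit.QuantumFields.YangMills.Cruxes.OSLegsFromFemtoAndGap.DlrCollarTransfer
open Summit.QuantumFields.YangMills.Cruxes.OSLegsFromFemtoAndGap.DlrCollarTransfer.StubLower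
  (exists_abs_dens_le le_depth_cube)
open Summit.QuantumFields.YangMills.Cruxes.NT.Reference (abs_torusCov_sub_torusE_kerCov_le dens_supp_window_of_depth_pos)
open Summit.QuantumFields.YangMills.Cruxes.ResponseLocalisation.Femto (abs_apply_le_norm)

/-! ## §1 The scale-free bound from the femto boundary law -/

section ScaleFree

variable {G : Type} [Group G] [TopologicalSpace G] [IsTopologicalGroup G] [CompactSpace G]
  [MeasurableSpace G] [BorelSpace G] (r : LatticeRep G)

/-- **Local scale-free kernel bound from the femto boundary law** (body form): `FBL G r a` gives `MomentBounds G r a`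
(`DlrCollarTransfer.stub_collar`), whose `n = 2` instance is `d⁸|torusCov| ≤ C₁(ℓ)` at physical separation `≤ ℓ`, every `ℓ`
(`localScaleFree_of_momentBounds`, p593932). [folklore] -/
theorem localScaleFree_of_fbl {a : ℝ → ℝ} (ha : ∀ β, 0 < a β) (ha0 : Tendsto a atTop (𝓝 0)) (hF : FBL G r a)
    (ℓ : ℝ) (hℓ : 0 < ℓ) :
    ∃ C₁ : ℝ, ∃ n₀ : ℕ, ∃ β₀ : ℝ, ∀ β : ℝ, β₀ ≤ β → ∀ (L : ℕ) (x y : Fin 4 → ℤ),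
      (n₀ : ℝ) ≤ torusDist L x y → a β * torusDist L x y ≤ ℓ →
        torusDist L x y ^ 8 * |torusCov G r β L x y| ≤ C₁ :=
  localScaleFree_of_momentBounds r ha ha0 (stub_collar G r a hF) ℓ hℓ

end ScaleFree


/-! ## §2 The log ceiling from the femto boundary law and a femto log two-point law -/

section Femto

variable {G : Type} [Group G] [TopologicalSpace G] [IsTopologicalGroup G] [CompactSpace G]
  [MeasurableSpace G] [BorelSpace G] (r : LatticeRep G)

/-- **The log ceiling from femto data (body form).**  For a unit map `a → 0⁺`: the local scale-free bound at range `1/2`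
(`d⁸|torusCov| ≤ C₁'`), the femto boundary law `FBL G r a`, and the FEMTO LOG TWO-POINT LAW — on every femto cube
(`b·a(β) ≤ ℓ₂`), for EVERY exterior `η`, pairs `x, y` with `n₀ ≤ ‖y−x‖` at collar depth `K(s)·‖y−x‖ ≤ depth` (`s = ‖y−x‖·a(β)`,
`K ≥ 1`, `s·K(s) → 0`) have `‖y−x‖⁸ |kerCov_η(dens x, dens y)| ≤ C₂/log²(1/s)` — together give the running-coupling ceiling
`d⁸|torusCov β L x y| ≤ C₀/log²(1/(a(β)d))` for `n₀' ≤ d`, `a(β)d ≤ 1/2`, on all tori `a(β)·L ≥ Λ₀`.  One torus DLR step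
through a cube of physical size `≈ ℓ/4` around `x` (`abs_torusCov_le_of_cube`): the femto law bounds the conditional
covariance, `FBL` the covariance of the conditional means (`4(C₁/D⁴)²`, `d/D ≤ 16s/(3ℓ)`, `s⁸log²(1/s) ≤ 1`); the range
`s ≥ ℓ*` is the scale-free bound. [folklore] -/
theorem logCeiling_of_femto {a : ℝ → ℝ} (ha : ∀ β, 0 < a β) (ha0 : Tendsto a atTop (𝓝 0))
    (hSF : ∃ C₁ : ℝ, ∃ n₁ : ℕ, ∃ β₁ : ℝ, ∀ β : ℝ, β₁ ≤ β → ∀ (L : ℕ) (x y : Fin 4 → ℤ),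
      (n₁ : ℝ) ≤ torusDist L x y → a β * torusDist L x y ≤ 1 / 2 →
        torusDist L x y ^ 8 * |torusCov G r β L x y| ≤ C₁)
    (hF : FBL G r a)
    (hLog : ∃ (ℓ₂ C₂ β₂ : ℝ) (K : ℝ → ℝ) (n₀ : ℕ), 0 < ℓ₂ ∧ (∀ s, 1 ≤ K s) ∧
          Filter.Tendsto (fun s : ℝ => s * K s) (nhdsWithin 0 (Set.Ioi 0)) (nhds 0) ∧
          ∀ β : ℝ, β₂ ≤ β → ∀ (c : Fin 4 → ℤ) (b : ℕ), (b : ℝ) * a β ≤ ℓ₂ →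
            ∀ (η : LGConfig 4 G) (x y : Fin 4 → ℤ), (n₀ : ℝ) ≤ ‖siteToE (y - x)‖ →
              K (‖siteToE (y - x)‖ * a β) * ‖siteToE (y - x)‖ ≤ (depth c b x : ℝ) →
              K (‖siteToE (y - x)‖ * a β) * ‖siteToE (y - x)‖ ≤ (depth c b y : ℝ) →
                ‖siteToE (y - x)‖ ^ 8 * |kerCov G r β c b η (dens G r x) (dens G r y)| ≤
                  C₂ / Real.log (1 / (‖siteToE (y - x)‖ * a β)) ^ 2) :
    ∃ C₀ : ℝ, ∃ n₀ : ℕ, ∃ β₀ Λ₀ : ℝ, ∀ β : ℝ, β₀ ≤ β → ∀ L : ℕ, Λ₀ ≤ a β * L →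
      ∀ x ∈ box 4 L, ∀ y ∈ box 4 L,
        (n₀ : ℝ) ≤ torusDist L x y → a β * torusDist L x y ≤ 1 / 2 →
          torusDist L x y ^ 8 * |torusCov G r β L x y| ≤ C₀ / Real.log (1 / (a β * torusDist L x y)) ^ 2 := by
  obtain ⟨C₁', n₁, β₁, H1⟩ := hSF
  obtain ⟨C₁, βF, ℓ₁, p, hℓ₁, hC₁, HF⟩ := hF
  obtain ⟨ℓ₂, C₂, β₂, K, n₀, hℓ₂, hK1, hK0, H2⟩ := hLog
  -- the common femto range
  set ℓ : ℝ := min ℓ₁ ℓ₂ with hℓdef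
  have hℓ : 0 < ℓ := lt_min hℓ₁ hℓ₂
  have hℓ₁' : ℓ ≤ ℓ₁ := min_le_left _ _
  have hℓ₂' : ℓ ≤ ℓ₂ := min_le_right _ _
  -- collar room: `s K(s) ≤ ℓ/16` for `0 < s < u`
  have hev : ∀ᶠ s in nhdsWithin (0 : ℝ) (Set.Ioi 0), s * K s ∈ Set.Iic (ℓ / 16) :=
    hK0.eventually (Iic_mem_nhds (by positivity))
  obtain ⟨u, hu, hU⟩ := mem_nhdsGT_iff_exists_Ioo_subset.1 hev
  have hu0 : 0 < u := hu
  -- the split point `ℓ*`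
  set ls : ℝ := min (u / 2) (min (ℓ / 16) (1 / 2)) with hlsdef
  have hls0 : 0 < ls := lt_min (by positivity) (lt_min (by positivity) (by norm_num))
  have hlsu : ls < u := lt_of_le_of_lt (min_le_left _ _) (by linarith)
  have hlsℓ : ls ≤ ℓ / 16 := le_trans (min_le_right _ _) (min_le_left _ _)
  have hls1 : ls ≤ 1 / 2 := le_trans (min_le_right _ _) (min_le_right _ _)
  -- small lattice spacing
  obtain ⟨βa, Ha⟩ := Filter.eventually_atTop.1 (ha0.eventually (Iic_mem_nhds (show (0 : ℝ) < ℓ / 16 by positivity)))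
  -- constants
  set A : ℝ := 4 * C₁ ^ 2 * (16 / (3 * ℓ)) ^ 8 with hAdef
  have hA : 0 ≤ A := by positivity
  refine ⟨max C₁' 0 * Real.log (1 / ls) ^ 2 + (max C₂ 0 + A), max (max n₀ n₁) 1,
    max (max β₁ βF) (max β₂ βa), ℓ + 1, fun β hβ L hL x _ y _ hn hd => ?_⟩
  have hβ₁ : β₁ ≤ β := le_trans (le_max_left _ _) (le_trans (le_max_left _ _) hβ)
  have hβF : βF ≤ β := le_trans (le_max_right _ _) (le_trans (le_max_left _ _) hβ)
  have hβ₂ : β₂ ≤ β := le_trans (le_max_left _ _) (le_trans (le_max_right _ _) hβ)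
  have hβa : βa ≤ β := le_trans (le_max_right _ _) (le_trans (le_max_right _ _) hβ)
  have hα : 0 < a β := ha β
  have hαℓ : a β ≤ ℓ / 16 := Ha β hβa
  set d : ℝ := torusDist L x y with hddef
  have hn₀ : (n₀ : ℝ) ≤ d := le_trans (by exact_mod_cast (le_max_left n₀ n₁).trans (le_max_left _ 1)) hn
  have hn₁ : (n₁ : ℝ) ≤ d := le_trans (by exact_mod_cast (le_max_right n₀ n₁).trans (le_max_left _ 1)) hn
  have hd1 : (1 : ℝ) ≤ d := le_trans (by exact_mod_cast le_max_right (max n₀ n₁) 1) hn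
  have hd0 : 0 < d := by linarith
  set s : ℝ := a β * d with hsdef
  have hs0 : 0 < s := mul_pos hα hd0
  have hs1 : s ≤ 1 / 2 := hd
  have hlog2 : 0 < Real.log (1 / s) := Real.log_pos (by rw [lt_div_iff₀ hs0]; linarith)
  have hlogls : 0 < Real.log (1 / ls) := Real.log_pos (by rw [lt_div_iff₀ hls0]; linarith)
  -- it suffices to bound `d⁸|Cov|·log²(1/s)`
  rw [le_div_iff₀ (pow_pos hlog2 2)]
  rcases le_or_gt ls s with hcase | hcase
  · -- scale-free range `ℓ* ≤ s ≤ 1/2`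
    have h1 := H1 β hβ₁ L x y hn₁ hd
    have hlogle : Real.log (1 / s) ≤ Real.log (1 / ls) :=
      Real.log_le_log (by positivity) (by rw [div_le_div_iff₀ hs0 hls0]; linarith)
    have hsq : Real.log (1 / s) ^ 2 ≤ Real.log (1 / ls) ^ 2 := by gcongr
    have hnn : 0 ≤ d ^ 8 * |torusCov G r β L x y| := by positivity
    calc d ^ 8 * |torusCov G r β L x y| * Real.log (1 / s) ^ 2
        ≤ max C₁' 0 * Real.log (1 / ls) ^ 2 := by
          exact mul_le_mul (h1.trans (le_max_left _ _)) hsq (sq_nonneg _) (le_max_right _ _)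
      _ ≤ max C₁' 0 * Real.log (1 / ls) ^ 2 + (max C₂ 0 + A) :=
          le_add_of_nonneg_right (add_nonneg (le_max_right _ _) hA)
  · -- femto range `s < ℓ*`: one DLR step through the cube of radius `R` around `x`
    have hsK : s * K s ≤ ℓ / 16 := hU ⟨hs0, hcase.trans hlsu⟩
    have hsℓ : s ≤ ℓ / 16 := (hcase.le).trans hlsℓ
    have hα2 : a β ≤ 1 / 2 := le_trans (le_mul_of_one_le_right hα.le hd1) hd
    obtain ⟨R, hRdef⟩ : ∃ R : ℕ, R = ⌊ℓ / (4 * a β)⌋₊ := ⟨_, rfl⟩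
    have hRle : (R : ℝ) ≤ ℓ / (4 * a β) := by rw [hRdef]; exact Nat.floor_le (by positivity)
    obtain ⟨hfem, hD₀, hD3, hq16, hdD⟩ := femto_cube_room hα hαℓ hℓ hs0 hsℓ hsdef hRdef
    have hfem₁ : ((2 * R + 1 : ℕ) : ℝ) * a β ≤ ℓ₁ := hfem.trans hℓ₁'
    have hfem₂ : ((2 * R + 1 : ℕ) : ℝ) * a β ≤ ℓ₂ := hfem.trans hℓ₂'
    have hRL : 2 * R + 1 + 3 ≤ 2 * L + 1 := femto_cube_fits hα hα2 hℓ hRle hL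
    -- the cyclic representative `w` of `y − x`; both sites deep in the cube
    obtain ⟨w, hwdef⟩ : ∃ w : Fin 4 → ℤ, w = fun k : Fin 4 => ((((y k - x k : ℤ) : ZMod (2 * L + 1))).valMinAbs : ℤ) :=
      ⟨_, rfl⟩
    have hnw : ‖siteToE w‖ = d := by rw [hwdef, norm_wrep']
    have hwj : ∀ j, |(((x + w) j : ℤ) : ℝ) - x j| ≤ d := fun j => by
      have : (((x + w) j : ℤ) : ℝ) - x j = ((w j : ℤ) : ℝ) := by push_cast [Pi.add_apply]; ring
      rw [this, ← hnw]
      exact abs_apply_le_norm w j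
    have hxj : ∀ j, |((x j : ℤ) : ℝ) - x j| ≤ (0 : ℝ) := fun j => by simp
    obtain ⟨D, hDdef⟩ : ∃ D : ℝ, D = (R : ℝ) + 1 - d := ⟨_, rfl⟩
    rw [← hDdef] at hD₀ hD3 hdD
    have hDpos : 0 < D := lt_of_lt_of_le (by norm_num) hD3
    have hdepxw : D ≤ (depth (fun j => x j - R) (2 * R + 1) (x + w) : ℝ) := by
      rw [hDdef]; exact le_depth_cube x (x + w) R hwj
    have hdepx : D ≤ (depth (fun j => x j - R) (2 * R + 1) x : ℝ) := by
      have := le_depth_cube x x R hxj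
      rw [hDdef]
      linarith [hd0]
    have hdepxw2 : 2 ≤ depth (fun j => x j - R) (2 * R + 1) (x + w) := by
      have : (2 : ℝ) ≤ (depth (fun j => x j - R) (2 * R + 1) (x + w) : ℝ) := by linarith
      exact_mod_cast this
    have hdepx2 : 2 ≤ depth (fun j => x j - R) (2 * R + 1) x := by
      have : (2 : ℝ) ≤ (depth (fun j => x j - R) (2 * R + 1) x : ℝ) := by linarith
      exact_mod_cast this
    -- FBL: one-point kernel means within `C₁/D⁴` of `p β`
    have hpow : ∀ {t : ℝ}, D ≤ t → C₁ / t ^ 4 ≤ C₁ / D ^ 4 := fun ht =>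
      div_le_div_of_nonneg_left hC₁ (pow_pos hDpos 4) (pow_le_pow_left₀ hDpos.le ht 4)
    have hB₁ : ∀ η, |kerE G r β (fun j => x j - R) (2 * R + 1) η (dens G r x) - p β| ≤ C₁ / D ^ 4 := fun η =>
      (HF β hβF _ _ hfem₁ η x hdepx2).trans (hpow hdepx)
    have hB₂ : ∀ η, |kerE G r β (fun j => x j - R) (2 * R + 1) η (dens G r (x + w)) - p β| ≤ C₁ / D ^ 4 := fun η =>
      (HF β hβF _ _ hfem₁ η (x + w) hdepxw2).trans (hpow hdepxw)
    -- the femto log law: conditional covariance `≤ C₂/(d⁸ log²(1/s))`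
    have hsub : x + w - x = w := add_sub_cancel_left x w
    have hds : d * a β = s := by rw [hsdef, mul_comm]
    have hKd : K (‖siteToE (x + w - x)‖ * a β) * ‖siteToE (x + w - x)‖ ≤ D := by
      rw [hsub, hnw, hds]
      have hdsa : d = s / a β := by rw [hsdef]; field_simp
      have e1 : K s * d = (s * K s) / a β := by rw [hdsa]; ring
      rw [e1]
      calc s * K s / a β ≤ (ℓ / 16) / a β := div_le_div_of_nonneg_right hsK hα.le
        _ ≤ 3 * ℓ / (16 * a β) := hq16
        _ ≤ D := hD₀
    have hC : ∀ η, |kerCov G r β (fun j => x j - R) (2 * R + 1) η (dens G r x) (dens G r (x + w))| ≤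
        C₂ / (d ^ 8 * Real.log (1 / s) ^ 2) := fun η => by
      have h := H2 β hβ₂ _ _ hfem₂ η x (x + w) (by rw [hsub, hnw]; exact hn₀) (hKd.trans hdepx) (hKd.trans hdepxw)
      rw [hsub, hnw, hds] at h
      rw [le_div_iff₀ (mul_pos (pow_pos hd0 8) (pow_pos hlog2 2))]
      calc |kerCov G r β (fun j => x j - R) (2 * R + 1) η (dens G r x) (dens G r (x + w))| *
            (d ^ 8 * Real.log (1 / s) ^ 2)
          = d ^ 8 * |kerCov G r β (fun j => x j - R) (2 * R + 1) η (dens G r x) (dens G r (x + w))| *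
              Real.log (1 / s) ^ 2 := by ring
        _ ≤ C₂ / Real.log (1 / s) ^ 2 * Real.log (1 / s) ^ 2 := mul_le_mul_of_nonneg_right h (sq_nonneg _)
        _ = C₂ := div_mul_cancel₀ C₂ (pow_pos hlog2 2).ne'
    -- one DLR step, periodicity, bookkeeping
    have hpair := abs_torusCov_le_of_cube r β x w R L hRL
      (one_le_two.trans hdepx2) (one_le_two.trans hdepxw2) hB₁ hB₂ hC
    have hper : torusCov G r β L x y = torusCov G r β L x (x + w) := by
      rw [hwdef]; exact torusCov_eq_torusCov_add_wrep r β L x y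
    have hmain := femto_bookkeeping hd0 hDpos hℓ hs0 (by linarith) hlog2 hdD hpair
    rw [hper]
    have h0 : 0 ≤ max C₁' 0 * Real.log (1 / ls) ^ 2 := by positivity
    have hA' : C₂ + 4 * C₁ ^ 2 * (16 / (3 * ℓ)) ^ 8 ≤ max C₂ 0 + A := by
      rw [hAdef]; exact add_le_add (le_max_left C₂ 0) le_rfl
    exact (hmain.trans hA').trans (le_add_of_nonneg_left h0)

end Femto

end Summit.QuantumFields.YangMills.Cruxes.RunningCouplingCeiling.Pointwise

end
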